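import Summits.Langlands.Langlands.Theses.BaseFieldAscent
import Summits.Langlands.Langlands.Theorems.BaseFieldAscentAscentConjugationSolvableStubPrimeTowerInduction
import Summits.Langlands.Langlands.Theorems.SmithKummerSeedAscentConjugationSolvableSplit

/-!
# `BaseFieldAscent.AscentConjugationSolvable` from reciprocity ascent AND descent along Galois layers of
prime degree (crux stmt-Langlands-1094, line `registered`; `--supports` file = the line's COMPOSITION with the
tower stub discharged; closes nothing)

The crux (route `BaseFieldAscent`, rank 3; decl shared verbatim with routes `CMFern`, `SmithKummerSeed`):
reciprocity for `GL_n` over every totally real or CM field (both directions, every finite place, all `n`)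
implies reciprocity over every CONJUGATION-SOLVABLE number field `F` (`F₀ ⊆ F ⊆ E`, `F₀` totally real,
`E/F₀` finite Galois with solvable group).

This file proves it, sorry-free, from the two PRIME-LAYER transfer statements — the registered stubs
`stub_primeAscent` / `stub_primeDescent` of the line, which are verbatim the bodies of the crux items
stmt-Langlands-18649 `SmithKummerSeed.CyclicPrimeAscent` (UP one Galois layer of prime degree: automorphic
induction, Clifford theory, de-induction over twists; Arthur–Clozel Ch. 3 Thms 4.2/5.1/6.2, Taylor 1994 §3)
and stmt-Langlands-18645 `SmithKummerSeed.CyclicPrimeDescent` (DOWN one Galois layer of prime degree: cyclic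
descent; its direction (A) at the INERT places is the crux's recorded open residue — solvable non-normal base
change, Arthur–Clozel Ch. 3 §7 closing remark, Rajan 2002):

* `ascentConjugationSolvable_of_primeLayers` — hypotheses written out; the Galois-theoretic engine is the
  landed tower stub `BaseFieldAscentAscentConjugationSolvable.stub_primeTowerInduction` (p150349), used UP
  with `P := Recip` and DOWN with the ascending predicate `P := fun X => Recip X → Recip F`;
* `ascentConjugationSolvable_of_pieces` — the same over the ROUTE DECLS of the two items, by name (registered on
  the crux as the named sub-goal `ascentConjugationSolvable_of_pieces`, the line's composition);
* `ascentConjugationSolvable_iff_smithKummerSeed` — the `BaseFieldAscent` and `SmithKummerSeed` decls of the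
  shared crux agree definitionally (so `SmithKummerSeedAscentConjugationSolvableSplit` transfers verbatim).

Degenerate layers (`[E:F] = 1`, `[F:F₀] = 1`) are settled by transporting only `IsGalois` / `IsSolvable` /
`IsTotallyReal` along `F ≃ₐ[F₀] E`, resp. `F₀ ≃+* F`; NO transport of reciprocity data along field
isomorphisms is used (the reason the lead re-cut the line's cyclic layers to prime layers). The CM half of the
hypothesis is unused (CM fields are quadratic over totally real ones).

References: J. Arthur, L. Clozel, Ann. of Math. Stud. 120 (1989), Ch. 3 [ArthurClozelAMS120]; R. Taylor,
Invent. Math. 116 (1994) §3 [Taylor1994]; C. S. Rajan, MRL 9 (2002) [doi:10.4310/mrl.2002.v9.n4.a9].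
-/

set_option linter.dupNamespace false -- mandated Summit.Langlands.Langlands namespace (D-0017)

noncomputable section

namespace Summit.Langlands.Langlands.Theorems.BaseFieldAscentAscentConjugationSolvable

open Summit.Langlands

/-- The `BaseFieldAscent` and `SmithKummerSeed` route decls of the shared crux stmt-Langlands-1094 are the same
proposition (identical bodies): definitional `Iff.rfl`. [folklore] -/
theorem ascentConjugationSolvable_iff_smithKummerSeed :
    Summit.Langlands.Langlands.Theses.BaseFieldAscent.AscentConjugationSolvable ↔
      Summit.Langlands.Langlands.Theses.SmithKummerSeed.AscentConjugationSolvable :=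
  Iff.rfl

/-- **`AscentConjugationSolvable` from the two prime-layer transfers** (hypotheses written out: `hUp` = the
body of `SmithKummerSeed.CyclicPrimeAscent`, `hDown` = the body of `SmithKummerSeed.CyclicPrimeDescent`).
From the witness `F₀ ⊆ F ⊆ E`: reciprocity over the totally real floor `F₀`; `E/F` is Galois with solvable
group (restriction of scalars embeds `Gal(E/F)` into `Gal(E/F₀)`); degenerate top layer `[E:F] = 1`:
`F ≃ₐ[F₀] E`, so `F/F₀` is Galois with solvable group, and either `[F:F₀] = 1` (`F` is totally real — the
hypothesis applies) or reciprocity climbs `F₀ ↝ F` (tower stub with the prime ascent step); otherwise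
`1 < [E:F] ≤ [E:F₀]`: reciprocity climbs `F₀ ↝ E` and descends `E ↝ F` (tower stub applied to the ascending
predicate `X ↦ (Recip X → Recip F)`, whose prime step is the prime descent composed on the left).
[cite: ArthurClozelAMS120, Ch. 3 Thm. 4.2 and Thm. 6.2] -/
theorem ascentConjugationSolvable_of_primeLayers
    (hUp : ∀ (K L : Type) [Field K] [NumberField K] [Field L] [NumberField L] [Algebra K L]
      [IsGalois K L], (Module.finrank K L).Prime →
      (∃ R : ReciprocityData K, ∀ n : ℕ, 0 < n →
          ∀ hcpt : Literature.NumberTheory.Automorphic.isCompact_glFiniteIntegralLevel n K,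
            GlobalLanglandsCorrespondenceGLn n K R hcpt) →
      ∃ R : ReciprocityData L, ∀ n : ℕ, 0 < n →
          ∀ hcpt : Literature.NumberTheory.Automorphic.isCompact_glFiniteIntegralLevel n L,
            GlobalLanglandsCorrespondenceGLn n L R hcpt)
    (hDown : ∀ (K L : Type) [Field K] [NumberField K] [Field L] [NumberField L] [Algebra K L]
      [IsGalois K L], (Module.finrank K L).Prime →
      (∃ R : ReciprocityData L, ∀ n : ℕ, 0 < n →
          ∀ hcpt : Literature.NumberTheory.Automorphic.isCompact_glFiniteIntegralLevel n L,
            GlobalLanglandsCorrespondenceGLn n L R hcpt) →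
      ∃ R : ReciprocityData K, ∀ n : ℕ, 0 < n →
          ∀ hcpt : Literature.NumberTheory.Automorphic.isCompact_glFiniteIntegralLevel n K,
            GlobalLanglandsCorrespondenceGLn n K R hcpt) :
    Summit.Langlands.Langlands.Theses.BaseFieldAscent.AscentConjugationSolvable := by
  intro hTRCM F _ _ hF
  obtain ⟨F₀, E, iF₀, iNF₀, iE, iNE, iA₀, iA, iA₀E, iST, iGal, hTR, hsolv⟩ := hF
  letI := iF₀; letI := iNF₀; letI := iE; letI := iNE; letI := iA₀; letI := iA; letI := iA₀E
  haveI := iST; haveI := iGal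
  -- (1) reciprocity over the totally real floor `F₀` (the TR ∪ CM hypothesis of the crux)
  have hRF₀ : ∃ R : ReciprocityData F₀, ∀ n : ℕ, 0 < n →
      ∀ hcpt : Literature.NumberTheory.Automorphic.isCompact_glFiniteIntegralLevel n F₀,
        GlobalLanglandsCorrespondenceGLn n F₀ R hcpt :=
    hTRCM F₀ (Or.inl hTR)
  haveI : FiniteDimensional F₀ E := Module.Finite.of_restrictScalars_finite ℚ F₀ E
  haveI : FiniteDimensional F₀ F := Module.Finite.of_restrictScalars_finite ℚ F₀ F
  haveI : FiniteDimensional F E := Module.Finite.of_restrictScalars_finite ℚ F E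
  -- (2) `E/F` is Galois, and `Gal(E/F)` embeds in the solvable `Gal(E/F₀)`
  haveI : IsGalois F E := IsGalois.tower_top_of_isGalois F₀ F E
  have hsolvF : IsSolvable (E ≃ₐ[F] E) := by
    let φ : (E ≃ₐ[F] E) →* (E ≃ₐ[F₀] E) :=
      { toFun := fun σ => σ.restrictScalars F₀
        map_one' := AlgEquiv.ext fun _ => rfl
        map_mul' := fun _ _ => AlgEquiv.ext fun _ => rfl }
    haveI : IsSolvable (E ≃ₐ[F₀] E) := hsolv
    exact solvable_of_solvable_injective (f := φ) (AlgEquiv.restrictScalars_injective F₀)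
  by_cases hFE : Module.finrank F E = 1
  · -- (3a) degenerate top layer: `F ≃ E` over `F₀`, so `F/F₀` is itself Galois with solvable group
    have hbij : Function.Bijective (algebraMap F E) :=
      (Algebra.finrank_eq_one_iff_bijective_algebraMap).mp hFE
    let e : F ≃ₐ[F₀] E := AlgEquiv.ofBijective (IsScalarTower.toAlgHom F₀ F E) hbij
    haveI : IsGalois F₀ F := IsGalois.of_algEquiv e.symm
    have hsolvF₀F : IsSolvable (F ≃ₐ[F₀] F) := by
      haveI : IsSolvable (E ≃ₐ[F₀] E) := hsolv
      exact solvable_of_surjective (f := e.symm.autCongr.toMonoidHom) e.symm.autCongr.surjective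
    by_cases hF₀F : Module.finrank F₀ F = 1
    · -- doubly degenerate: `F ≃ F₀` is totally real, the hypothesis applies to `F` itself
      have hbij₀ : Function.Bijective (algebraMap F₀ F) :=
        (Algebra.finrank_eq_one_iff_bijective_algebraMap).mp hF₀F
      haveI : NumberField.IsTotallyReal F₀ := hTR
      haveI : NumberField.IsTotallyReal F :=
        NumberField.IsTotallyReal.ofRingEquiv (RingEquiv.ofBijective (algebraMap F₀ F) hbij₀)
      exact hTRCM F (Or.inl inferInstance)
    · -- UP from `F₀` to `F` along the solvable Galois extension `F/F₀` of degree `> 1`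
      exact stub_primeTowerInduction (fun (K : Type) [Field K] [NumberField K] =>
          ∃ R : ReciprocityData K, ∀ n : ℕ, 0 < n →
            ∀ hcpt : Literature.NumberTheory.Automorphic.isCompact_glFiniteIntegralLevel n K,
              GlobalLanglandsCorrespondenceGLn n K R hcpt)
        hUp F₀ F hsolvF₀F
        (lt_of_le_of_ne (Nat.succ_le_of_lt Module.finrank_pos) (Ne.symm hF₀F)) hRF₀
  · -- (3b) generic case: `1 < [E:F] ≤ [E:F₀]`
    have hltFE : 1 < Module.finrank F E :=
      lt_of_le_of_ne (Nat.succ_le_of_lt Module.finrank_pos) (Ne.symm hFE)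
    have hltE : 1 < Module.finrank F₀ E :=
      calc 1 < Module.finrank F E := hltFE
        _ ≤ Module.finrank F₀ F * Module.finrank F E := Nat.le_mul_of_pos_left _ Module.finrank_pos
        _ = Module.finrank F₀ E := Module.finrank_mul_finrank F₀ F E
    -- UP: climb the solvable Galois extension `E/F₀` prime layer by prime layer
    have hRE : ∃ R : ReciprocityData E, ∀ n : ℕ, 0 < n →
        ∀ hcpt : Literature.NumberTheory.Automorphic.isCompact_glFiniteIntegralLevel n E,
          GlobalLanglandsCorrespondenceGLn n E R hcpt :=
      stub_primeTowerInduction (fun (K : Type) [Field K] [NumberField K] =>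
          ∃ R : ReciprocityData K, ∀ n : ℕ, 0 < n →
            ∀ hcpt : Literature.NumberTheory.Automorphic.isCompact_glFiniteIntegralLevel n K,
              GlobalLanglandsCorrespondenceGLn n K R hcpt)
        hUp F₀ E hsolv hltE hRF₀
    -- DOWN: the ascending predicate `X ↦ (Recip X → Recip F)` holds at `F` trivially and climbs each
    -- prime layer by prime descent composed on the left; evaluate it at `E`.
    have hDesc :
        (∃ R : ReciprocityData E, ∀ n : ℕ, 0 < n →
          ∀ hcpt : Literature.NumberTheory.Automorphic.isCompact_glFiniteIntegralLevel n E,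
            GlobalLanglandsCorrespondenceGLn n E R hcpt) →
        ∃ R : ReciprocityData F, ∀ n : ℕ, 0 < n →
          ∀ hcpt : Literature.NumberTheory.Automorphic.isCompact_glFiniteIntegralLevel n F,
            GlobalLanglandsCorrespondenceGLn n F R hcpt :=
      stub_primeTowerInduction (fun (K : Type) [Field K] [NumberField K] =>
          (∃ R : ReciprocityData K, ∀ n : ℕ, 0 < n →
            ∀ hcpt : Literature.NumberTheory.Automorphic.isCompact_glFiniteIntegralLevel n K,
              GlobalLanglandsCorrespondenceGLn n K R hcpt) →
          ∃ R : ReciprocityData F, ∀ n : ℕ, 0 < n →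
            ∀ hcpt : Literature.NumberTheory.Automorphic.isCompact_glFiniteIntegralLevel n F,
              GlobalLanglandsCorrespondenceGLn n F R hcpt)
        (fun K L _ _ _ _ _ _ hp hK hL => hK (hDown K L hp hL)) F E hsolvF hltFE id
    exact hDesc hRE

/-- **The crux from the two piece ITEMS, by name**: `SmithKummerSeed.CyclicPrimeAscent` (stmt-Langlands-18649)
and `SmithKummerSeed.CyclicPrimeDescent` (stmt-Langlands-18645) imply `BaseFieldAscent.AscentConjugationSolvable`
(stmt-Langlands-1094). [cite: ArthurClozelAMS120, Ch. 3 Thm. 4.2 and Thm. 6.2] -/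
theorem ascentConjugationSolvable_of_pieces : Summit.Langlands.Langlands.Theses.SmithKummerSeed.CyclicPrimeAscent → Summit.Langlands.Langlands.Theses.SmithKummerSeed.CyclicPrimeDescent → Summit.Langlands.Langlands.Theses.BaseFieldAscent.AscentConjugationSolvable :=
  fun hUp hDown => ascentConjugationSolvable_of_primeLayers hUp hDown

/-- **The crux through the landed glue of route `SmithKummerSeed`**: the glue item
`SmithKummerSeed.AscentConjugationSolvableOfCyclicPrime` (stmt-Langlands-19073, proved:
`AscentConjugationSolvableSplit.ascentConjugationSolvableOfCyclicPrime_proof`) and the two pieces give the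
`SmithKummerSeed` decl of the crux, which IS the `BaseFieldAscent` decl
(`ascentConjugationSolvable_iff_smithKummerSeed`) — a second, independent derivation of
`ascentConjugationSolvable_of_pieces`. [cite: ArthurClozelAMS120, Ch. 3 Thm. 4.2 and Thm. 6.2] -/
theorem ascentConjugationSolvable_of_pieces'
    (hUp : Summit.Langlands.Langlands.Theses.SmithKummerSeed.CyclicPrimeAscent)
    (hDown : Summit.Langlands.Langlands.Theses.SmithKummerSeed.CyclicPrimeDescent) :
    Summit.Langlands.Langlands.Theses.BaseFieldAscent.AscentConjugationSolvable :=
  ascentConjugationSolvable_iff_smithKummerSeed.mpr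
    (AscentConjugationSolvableSplit.ascentConjugationSolvableOfCyclicPrime_proof hUp hDown)

end Summit.Langlands.Langlands.Theorems.BaseFieldAscentAscentConjugationSolvable

end
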